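import Summits.QuantumFields.YangMills.Theorems.ColdStartUniversalityColdStartSolutionsExistCoordMartingale
import Literature.Probability.Process.BrownianMotionProofs
import Literature.Probability.Distributions.GaussianMoments
import HarnessLib

/-!
# Route `ColdStartUniversality`, rung `stub_fixedCutoffMixing` of K_A1 (stmt-QuantumFields-24809):
# Gaussian increment moments of a Brownian coordinate conditionally on the JOINT past, and the
# second / fourth moments of elementary integrals of integrands bounded by `M`

Helper file (seat `ym-line-csu-p1`, g6) for the `WilsonMeasureLangevinInvariant` wall of the rung
(step 2, the Dynkin / Itô formula IN EXPECTATION for the SZZ system by second-order Taylor expansion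
along partitions; the remainder needs a moment of order `> 2` of the increments of Itô integrals of
bounded integrands).  For a Brownian vector `W` (`IsBrownianVec`) and its JOINT raw natural
filtration `𝓕`:

* `integral_mul_comp_coordSub` — factorisation `E[F g(W^i_t - W^i_s)] = E[F] ∫ g dN(0, t - s)` for
  `F` `𝓕_s`-measurable; whence `E[F ΔW] = E[F ΔW³] = 0`, `E[F ΔW²] = (t-s) E[F]`,
  `E[F ΔW⁴] = 3 (t-s)² E[F]` (`integral_mul_coordSub`, `…_sq`, `…_pow_three`, `…_pow_four`);
* `cellSum_moments` — for a bounded simple `H` with `|Hᵢ| ≤ M` and grid indices `p ≤ n`, the cell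
  sum `S = ∑_{p≤i<n} Hᵢ (W^k_{tᵢ₊₁} - W^k_{tᵢ})` is in `L⁴` with `E[S²] ≤ M² (tₙ - t_p)` and
  **`E[S⁴] ≤ 9 M⁴ (tₙ - t_p)²`** (induction over cells).

The passage to the Itô integral is in `…LatticeLangevinItoFourthMoment`.  No definition, no sorry,
standard axioms.  RECORD-rung plumbing (R3); the Yang–Mills mass gap is NOT proved.
-/

set_option autoImplicit false

noncomputable section

namespace Summit.QuantumFields.YangMills.Theorems.ColdStartUniversality

open MeasureTheory ProbabilityTheory Filter Finset
open scoped NNReal ENNReal Topology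
open Literature.Probability.Process

/-! ### Elementary inequalities -/

/-- `a³ b ≤ a⁴ + b⁴` for `a, b ≥ 0`. [folklore] -/
private theorem pow_three_mul_le {a b : ℝ} (ha : 0 ≤ a) (hb : 0 ≤ b) : a ^ 3 * b ≤ a ^ 4 + b ^ 4 := by
  rcases le_or_gt b a with h | h
  · calc a ^ 3 * b ≤ a ^ 3 * a := by gcongr
      _ = a ^ 4 := by ring
      _ ≤ a ^ 4 + b ^ 4 := le_add_of_nonneg_right (by positivity)
  · calc a ^ 3 * b ≤ b ^ 3 * b := by gcongr
      _ = b ^ 4 := by ring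
      _ ≤ a ^ 4 + b ^ 4 := le_add_of_nonneg_left (by positivity)

/-- `a² b² ≤ a⁴ + b⁴`. [folklore] -/
private theorem sq_mul_sq_le (a b : ℝ) : a ^ 2 * b ^ 2 ≤ a ^ 4 + b ^ 4 := by
  nlinarith [sq_nonneg (a ^ 2 - b ^ 2), sq_nonneg a, sq_nonneg b]

section Vec

variable {Ω : Type*} {mΩ : MeasurableSpace Ω} {P : Measure Ω} {d : ℕ}
  {W : ℝ≥0 → Ω → (Fin d → ℝ)}

/-! ### Gaussian increments of one coordinate, conditionally on the joint past -/

/-- A real random variable with law `N(0, v)` has moments of all orders. [folklore] -/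
theorem memLp_of_map_eq_gaussianReal {X : Ω → ℝ} (hX : Measurable X) {v : ℝ≥0}
    (hlaw : P.map X = gaussianReal 0 v) (p : ℝ≥0) : MemLp X p P := by
  have h : MemLp id p (P.map X) := by rw [hlaw]; exact memLp_id_gaussianReal p
  exact (memLp_map_measure_iff h.aestronglyMeasurable hX.aemeasurable).1 h

/-- The coordinate increment `W^i_t - W^i_s` (`s ≤ t`) is in every `Lᵖ`. [folklore] -/
theorem memLp_coordSub [IsProbabilityMeasure P] (hW : IsBrownianVec W P) {s t : ℝ≥0} (hst : s ≤ t)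
    (i : Fin d) (p : ℝ≥0) : MemLp (fun ω => W t ω i - W s ω i) p P := by
  obtain ⟨h, rfl⟩ : ∃ h : ℝ≥0, t = s + h := ⟨t - s, (add_tsub_cancel_of_le hst).symm⟩
  exact memLp_of_map_eq_gaussianReal ((measurable_coord hW _ i).sub (measurable_coord hW _ i))
    (map_coordIncr hW s h i) p

/-- **Factorisation against a coordinate increment after `s`**: for `F` `𝓕_s`-measurable (joint raw
natural filtration) and Borel `g`, `E[F g(W^i_t - W^i_s)] = E[F] ∫ g dN(0, t - s)` (independence of
the increment from the joint past + its Gaussian law; no integrability needed). [folklore] -/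
theorem integral_mul_comp_coordSub [IsProbabilityMeasure P] (hW : IsBrownianVec W P) {s t : ℝ≥0}
    (hst : s ≤ t) (i : Fin d) {F : Ω → ℝ} (hF : Measurable[hW.natFiltration s] F) {g : ℝ → ℝ}
    (hg : Measurable g) :
    ∫ ω, F ω * g (W t ω i - W s ω i) ∂P = (∫ ω, F ω ∂P) * ∫ x, g x ∂gaussianReal 0 (t - s) := by
  obtain ⟨h, rfl⟩ : ∃ h : ℝ≥0, t = s + h := ⟨t - s, (add_tsub_cancel_of_le hst).symm⟩
  rw [add_tsub_cancel_left]
  have hFm : Measurable F := hF.mono (hW.natFiltration.le s) le_rfl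
  have hΔ : Measurable fun ω => W (s + h) ω i - W s ω i :=
    (measurable_coord hW _ i).sub (measurable_coord hW _ i)
  have hind : IndepFun F (fun ω => W (s + h) ω i - W s ω i) P := by
    rw [IndepFun_iff_Indep]
    exact indep_of_indep_of_le_left (indep_comap_coordIncr_natFiltration hW s h i).symm hF.comap_le
  have hind' : IndepFun F (fun ω => g (W (s + h) ω i - W s ω i)) P := hind.comp measurable_id hg
  rw [hind'.integral_fun_mul_eq_mul_integral hFm.aestronglyMeasurable
    (hg.comp hΔ).aestronglyMeasurable]
  congr 1
  rw [← map_coordIncr hW s h i, integral_map hΔ.aemeasurable hg.aestronglyMeasurable]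

/-- `E[F (W^i_t - W^i_s)] = 0` for `F` `𝓕_s`-measurable. [folklore] -/
theorem integral_mul_coordSub [IsProbabilityMeasure P] (hW : IsBrownianVec W P) {s t : ℝ≥0}
    (hst : s ≤ t) (i : Fin d) {F : Ω → ℝ} (hF : Measurable[hW.natFiltration s] F) :
    ∫ ω, F ω * (W t ω i - W s ω i) ∂P = 0 := by
  have h := integral_mul_comp_coordSub hW hst i hF measurable_id
  simp only [id_eq, integral_id_gaussianReal, mul_zero] at h
  exact h

/-- `E[F (W^i_t - W^i_s)²] = (t - s) E[F]` for `F` `𝓕_s`-measurable. [folklore] -/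
theorem integral_mul_coordSub_sq [IsProbabilityMeasure P] (hW : IsBrownianVec W P) {s t : ℝ≥0}
    (hst : s ≤ t) (i : Fin d) {F : Ω → ℝ} (hF : Measurable[hW.natFiltration s] F) :
    ∫ ω, F ω * (W t ω i - W s ω i) ^ 2 ∂P = ((t : ℝ) - s) * ∫ ω, F ω ∂P := by
  have h := integral_mul_comp_coordSub hW hst i hF (measurable_id.pow_const 2)
  have hv := variance_of_integral_eq_zero (μ := gaussianReal 0 (t - s)) (X := id)
    measurable_id.aemeasurable (by simp [integral_id_gaussianReal])
  rw [variance_id_gaussianReal] at hv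
  simp only [id_eq] at h hv
  rw [h, ← hv, NNReal.coe_sub hst, mul_comm]

/-- `E[F (W^i_t - W^i_s)³] = 0` for `F` `𝓕_s`-measurable. [folklore] -/
theorem integral_mul_coordSub_pow_three [IsProbabilityMeasure P] (hW : IsBrownianVec W P)
    {s t : ℝ≥0} (hst : s ≤ t) (i : Fin d) {F : Ω → ℝ} (hF : Measurable[hW.natFiltration s] F) :
    ∫ ω, F ω * (W t ω i - W s ω i) ^ 3 ∂P = 0 := by
  have h := integral_mul_comp_coordSub hW hst i hF (measurable_id.pow_const 3)
  have h3 := Literature.Probability.Distributions.integral_pow_odd_gaussianReal (t - s) 1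
  norm_num at h3
  simp only [id_eq] at h
  rw [h, h3, mul_zero]

/-- `E[F (W^i_t - W^i_s)⁴] = 3 (t - s)² E[F]` for `F` `𝓕_s`-measurable. [folklore] -/
theorem integral_mul_coordSub_pow_four [IsProbabilityMeasure P] (hW : IsBrownianVec W P)
    {s t : ℝ≥0} (hst : s ≤ t) (i : Fin d) {F : Ω → ℝ} (hF : Measurable[hW.natFiltration s] F) :
    ∫ ω, F ω * (W t ω i - W s ω i) ^ 4 ∂P = 3 * ((t : ℝ) - s) ^ 2 * ∫ ω, F ω ∂P := by
  have h := integral_mul_comp_coordSub hW hst i hF (measurable_id.pow_const 4)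
  simp only [id_eq] at h
  rw [h, integral_pow_four_gaussianReal, NNReal.coe_sub hst, mul_comm]

/-! ### Moments of elementary integrals of integrands bounded by `M` -/

/-- **Second and fourth moments of the cell sums of an elementary integral against a Brownian
coordinate (joint filtration)**: for a bounded simple `H` with `|Hᵢ| ≤ M` and grid indices `p ≤ n`,
the cell sum `S = ∑_{p≤i<n} Hᵢ (W^k_{tᵢ₊₁} - W^k_{tᵢ})` is in `L⁴`,
`E[S²] ≤ M² (tₙ - t_p)` and `E[S⁴] ≤ 9 M⁴ (tₙ - t_p)²`. [folklore] -/
theorem cellSum_moments [IsProbabilityMeasure P] (hW : IsBrownianVec W P) (k : Fin d)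
    (H : SimpleProcess mΩ hW.natFiltration) {M : ℝ} (hM : ∀ i ω, |H.value i ω| ≤ M) {p n : ℕ}
    (hpn : p ≤ n) (hn : n < H.times.length) :
    MemLp (fun ω => ∑ i ∈ Ico p n, H.value i ω * (W (H.time (i + 1)) ω k - W (H.time i) ω k)) 4 P ∧
    ∫ ω, (∑ i ∈ Ico p n, H.value i ω * (W (H.time (i + 1)) ω k - W (H.time i) ω k)) ^ 2 ∂P ≤
      M ^ 2 * ((H.time n : ℝ) - H.time p) ∧
    ∫ ω, (∑ i ∈ Ico p n, H.value i ω * (W (H.time (i + 1)) ω k - W (H.time i) ω k)) ^ 4 ∂P ≤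
      9 * M ^ 4 * ((H.time n : ℝ) - H.time p) ^ 2 := by
  induction n, hpn using Nat.le_induction with
  | base =>
    simp only [Ico_self, sum_empty, sub_self, mul_zero]
    refine ⟨memLp_const 0, ?_, ?_⟩ <;> simp
  | succ n hpn ih =>
    have hn' : n < H.times.length := by omega
    obtain ⟨hS4, hS2, hS4int⟩ := ih hn'
    set S : Ω → ℝ := fun ω ↦ ∑ i ∈ Ico p n, H.value i ω * (W (H.time (i + 1)) ω k - W (H.time i) ω k)
      with hSdef
    set a : Ω → ℝ := H.value n with hadef
    set D : Ω → ℝ := fun ω ↦ W (H.time (n + 1)) ω k - W (H.time n) ω k with hDdef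
    have htn : H.time n ≤ H.time (n + 1) := H.time_mono (Nat.le_succ n) hn
    have htp : H.time p ≤ H.time n := H.time_mono hpn hn'
    set δ : ℝ := (H.time (n + 1) : ℝ) - H.time n with hδdef
    have hδ0 : 0 ≤ δ := sub_nonneg.2 (NNReal.coe_le_coe.2 htn)
    have hτ0 : 0 ≤ (H.time n : ℝ) - H.time p := sub_nonneg.2 (NNReal.coe_le_coe.2 htp)
    -- measurability w.r.t. `𝓕 (tₙ)`
    have hSm : StronglyMeasurable[hW.natFiltration (H.time n)] S := by
      refine Finset.stronglyMeasurable_fun_sum _ fun i hi ↦ ?_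
      have hi' := mem_Ico.1 hi
      have h1 : H.time i ≤ H.time n := H.time_mono hi'.2.le hn'
      have h2 : H.time (i + 1) ≤ H.time n := H.time_mono (by omega) hn'
      exact ((H.stronglyMeasurable_value (by omega)).mono (hW.natFiltration.mono h1)).mul
        ((((stronglyAdapted_coord hW) k _).mono (hW.natFiltration.mono h2)).sub
          (((stronglyAdapted_coord hW) k _).mono (hW.natFiltration.mono h1)))
    have ham : StronglyMeasurable[hW.natFiltration (H.time n)] a := H.stronglyMeasurable_value hn'
    have hSm' : AEStronglyMeasurable S P := (hSm.mono (hW.natFiltration.le _)).aestronglyMeasurable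
    have ham' : AEStronglyMeasurable a P := (ham.mono (hW.natFiltration.le _)).aestronglyMeasurable
    have hD4 : MemLp D 4 P := by exact_mod_cast memLp_coordSub hW htn k 4
    have hDm' : AEStronglyMeasurable D P := hD4.1
    have haM : ∀ ω, |a ω| ≤ M := fun ω ↦ hM n ω
    -- `a D ∈ L⁴`, hence the new sum
    have haD4 : MemLp (fun ω ↦ a ω * D ω) 4 P :=
      hD4.of_le_mul (c := M) (ham'.mul hDm') (ae_of_all _ fun ω ↦ by
        rw [norm_mul, Real.norm_eq_abs, Real.norm_eq_abs]
        exact mul_le_mul_of_nonneg_right (haM ω) (abs_nonneg _))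
    have hsucc : ∀ ω, ∑ i ∈ Ico p (n + 1), H.value i ω * (W (H.time (i + 1)) ω k - W (H.time i) ω k)
        = S ω + a ω * D ω := fun ω ↦ by rw [sum_Ico_succ_top hpn]
    have hnew4 : MemLp (fun ω ↦ S ω + a ω * D ω) 4 P := hS4.add haD4
    -- integrable dominators `S⁴`, `D⁴`
    have iS4 : Integrable (fun ω ↦ S ω ^ 4) P := by
      have := hS4.integrable_norm_pow (by norm_num)
      simpa [Real.norm_eq_abs, Even.pow_abs (by decide : Even 4)] using this
    have iD4 : Integrable (fun ω ↦ D ω ^ 4) P := by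
      have := hD4.integrable_norm_pow (by norm_num)
      simpa [Real.norm_eq_abs, Even.pow_abs (by decide : Even 4)] using this
    have iS2 : Integrable (fun ω ↦ S ω ^ 2) P := (hS4.mono_exponent (by norm_num)).integrable_sq
    have iD2 : Integrable (fun ω ↦ D ω ^ 2) P := (hD4.mono_exponent (by norm_num)).integrable_sq
    have iDom : Integrable (fun ω ↦ S ω ^ 4 + D ω ^ 4) P := iS4.add iD4
    -- the mixed terms are integrable (dominated by multiples of `S⁴ + D⁴`)
    have hdom : ∀ {c : ℝ} {f : Ω → ℝ}, AEStronglyMeasurable f P →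
        (∀ ω, |f ω| ≤ c * (S ω ^ 4 + D ω ^ 4)) → Integrable f P := by
      intro c f hf hle
      exact (iDom.const_mul c).mono' hf (ae_of_all _ fun ω ↦ by
        rw [Real.norm_eq_abs]; exact hle ω)
    have i31 : Integrable (fun ω ↦ S ω ^ 3 * a ω * D ω) P := by
      refine hdom (c := M) ((hSm'.pow 3).mul ham' |>.mul hDm') fun ω ↦ ?_
      have hM0 : 0 ≤ M := (abs_nonneg _).trans (haM ω)
      have hY : |S ω| ^ 3 * |D ω| ≤ S ω ^ 4 + D ω ^ 4 := by
        have := pow_three_mul_le (abs_nonneg (S ω)) (abs_nonneg (D ω))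
        simpa [Even.pow_abs (by decide : Even 4)] using this
      rw [abs_mul, abs_mul, abs_pow]
      calc |S ω| ^ 3 * |a ω| * |D ω| ≤ |S ω| ^ 3 * M * |D ω| := by gcongr; exact haM ω
        _ = M * (|S ω| ^ 3 * |D ω|) := by ring
        _ ≤ M * (S ω ^ 4 + D ω ^ 4) := mul_le_mul_of_nonneg_left hY hM0
    have i22 : Integrable (fun ω ↦ S ω ^ 2 * a ω ^ 2 * D ω ^ 2) P := by
      refine hdom (c := M ^ 2) (((hSm'.pow 2).mul (ham'.pow 2)).mul (hDm'.pow 2)) fun ω ↦ ?_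
      rw [abs_mul, abs_mul, abs_pow, abs_pow, abs_pow]
      calc |S ω| ^ 2 * |a ω| ^ 2 * |D ω| ^ 2 ≤ |S ω| ^ 2 * M ^ 2 * |D ω| ^ 2 := by gcongr; exact haM ω
        _ = M ^ 2 * (S ω ^ 2 * D ω ^ 2) := by rw [sq_abs, sq_abs]; ring
        _ ≤ M ^ 2 * (S ω ^ 4 + D ω ^ 4) := by gcongr; exact sq_mul_sq_le _ _
    have i13 : Integrable (fun ω ↦ S ω * a ω ^ 3 * D ω ^ 3) P := by
      refine hdom (c := M ^ 3) ((hSm'.mul (ham'.pow 3)).mul (hDm'.pow 3)) fun ω ↦ ?_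
      have hM0 : 0 ≤ M := (abs_nonneg _).trans (haM ω)
      have hY : |D ω| ^ 3 * |S ω| ≤ S ω ^ 4 + D ω ^ 4 := by
        have := pow_three_mul_le (abs_nonneg (D ω)) (abs_nonneg (S ω))
        rw [add_comm] at this
        simpa [Even.pow_abs (by decide : Even 4)] using this
      rw [abs_mul, abs_mul, abs_pow, abs_pow]
      calc |S ω| * |a ω| ^ 3 * |D ω| ^ 3 ≤ |S ω| * M ^ 3 * |D ω| ^ 3 := by gcongr; exact haM ω
        _ = M ^ 3 * (|D ω| ^ 3 * |S ω|) := by ring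
        _ ≤ M ^ 3 * (S ω ^ 4 + D ω ^ 4) := mul_le_mul_of_nonneg_left hY (pow_nonneg hM0 3)
    have i04 : Integrable (fun ω ↦ a ω ^ 4 * D ω ^ 4) P := by
      refine hdom (c := M ^ 4) ((ham'.pow 4).mul (hDm'.pow 4)) fun ω ↦ ?_
      rw [abs_mul, abs_pow, abs_pow, Even.pow_abs (by decide : Even 4) (D ω)]
      calc |a ω| ^ 4 * D ω ^ 4 ≤ M ^ 4 * D ω ^ 4 := by gcongr; exact haM ω
        _ ≤ M ^ 4 * (S ω ^ 4 + D ω ^ 4) := by gcongr; exact le_add_of_nonneg_left (by positivity)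
    have i11 : Integrable (fun ω ↦ S ω * a ω * D ω) P :=
      (hS4.mono_exponent (by norm_num) : MemLp S 2 P).integrable_mul
        (haD4.mono_exponent (by norm_num) : MemLp (fun ω ↦ a ω * D ω) 2 P) |>.congr
        (ae_of_all _ fun ω ↦ by simp only [Pi.mul_apply]; ring)
    have i02 : Integrable (fun ω ↦ a ω ^ 2 * D ω ^ 2) P := by
      refine (iD2.const_mul (M ^ 2)).mono' ((ham'.pow 2).mul (hDm'.pow 2)) (ae_of_all _ fun ω ↦ ?_)
      rw [Real.norm_eq_abs, abs_mul, abs_pow, abs_pow, sq_abs (D ω)]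
      gcongr
      exact haM ω
    have iSa2 : Integrable (fun ω ↦ S ω ^ 2 * a ω ^ 2) P := by
      refine (iS2.const_mul (M ^ 2)).mono' ((hSm'.pow 2).mul (ham'.pow 2)) (ae_of_all _ fun ω ↦ ?_)
      rw [Real.norm_eq_abs, abs_mul, abs_pow, abs_pow, sq_abs (S ω), mul_comm]
      gcongr
      exact haM ω
    have ia2 : Integrable (fun ω ↦ a ω ^ 2) P :=
      (integrable_const (M ^ 2)).mono' (ham'.pow 2) (ae_of_all _ fun ω ↦ by
        rw [Real.norm_eq_abs, abs_pow]; exact pow_le_pow_left₀ (abs_nonneg _) (haM ω) 2)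
    have ia4 : Integrable (fun ω ↦ a ω ^ 4) P :=
      (integrable_const (M ^ 4)).mono' (ham'.pow 4) (ae_of_all _ fun ω ↦ by
        rw [Real.norm_eq_abs, abs_pow]; exact pow_le_pow_left₀ (abs_nonneg _) (haM ω) 4)
    -- the Gaussian factorisations (all weights are `𝓕 (tₙ)`-measurable)
    have mS := hSm.measurable
    have ma := ham.measurable
    have e31 : ∫ ω, S ω ^ 3 * a ω * D ω ∂P = 0 :=
      integral_mul_coordSub hW htn k ((mS.pow_const 3).mul ma)
    have e13 : ∫ ω, S ω * a ω ^ 3 * D ω ^ 3 ∂P = 0 :=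
      integral_mul_coordSub_pow_three hW htn k (mS.mul (ma.pow_const 3))
    have e22 : ∫ ω, S ω ^ 2 * a ω ^ 2 * D ω ^ 2 ∂P = δ * ∫ ω, S ω ^ 2 * a ω ^ 2 ∂P :=
      integral_mul_coordSub_sq hW htn k ((mS.pow_const 2).mul (ma.pow_const 2))
    have e04 : ∫ ω, a ω ^ 4 * D ω ^ 4 ∂P = 3 * δ ^ 2 * ∫ ω, a ω ^ 4 ∂P :=
      integral_mul_coordSub_pow_four hW htn k (ma.pow_const 4)
    have e11 : ∫ ω, S ω * a ω * D ω ∂P = 0 := integral_mul_coordSub hW htn k (mS.mul ma)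
    have e02 : ∫ ω, a ω ^ 2 * D ω ^ 2 ∂P = δ * ∫ ω, a ω ^ 2 ∂P :=
      integral_mul_coordSub_sq hW htn k (ma.pow_const 2)
    -- bounds on the weights
    have bSa2 : ∫ ω, S ω ^ 2 * a ω ^ 2 ∂P ≤ M ^ 2 * ∫ ω, S ω ^ 2 ∂P := by
      rw [← integral_const_mul]
      refine integral_mono iSa2 (iS2.const_mul _) fun ω ↦ ?_
      have : a ω ^ 2 ≤ M ^ 2 := by
        rw [← sq_abs]; exact pow_le_pow_left₀ (abs_nonneg _) (haM ω) 2
      simp only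
      nlinarith [sq_nonneg (S ω)]
    have ba2 : ∫ ω, a ω ^ 2 ∂P ≤ M ^ 2 := by
      have h := integral_mono ia2 (integrable_const (M ^ 2)) fun ω ↦ (show a ω ^ 2 ≤ M ^ 2 by
        rw [← sq_abs]; exact pow_le_pow_left₀ (abs_nonneg _) (haM ω) 2)
      simpa using h
    have ba4 : ∫ ω, a ω ^ 4 ∂P ≤ M ^ 4 := by
      have h := integral_mono ia4 (integrable_const (M ^ 4)) fun ω ↦ (show a ω ^ 4 ≤ M ^ 4 by
        rw [← Even.pow_abs (by decide : Even 4)]; exact pow_le_pow_left₀ (abs_nonneg _) (haM ω) 4)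
      simpa using h
    have hτδ : (H.time (n + 1) : ℝ) - H.time p = ((H.time n : ℝ) - H.time p) + δ := by rw [hδdef]; ring
    simp_rw [hsucc]
    rw [hτδ]
    refine ⟨hnew4, ?_, ?_⟩
    · -- second moment
      have hexp : (fun ω ↦ (S ω + a ω * D ω) ^ 2) =
          fun ω ↦ S ω ^ 2 + 2 * (S ω * a ω * D ω) + a ω ^ 2 * D ω ^ 2 := by
        funext ω; ring
      have i1 : Integrable (fun ω ↦ 2 * (S ω * a ω * D ω)) P := i11.const_mul 2
      have i12 : Integrable (fun ω ↦ S ω ^ 2 + 2 * (S ω * a ω * D ω)) P := iS2.add i1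
      rw [hexp, integral_add i12 i02, integral_add iS2 i1, integral_const_mul, e11, e02]
      have hδa : δ * ∫ ω, a ω ^ 2 ∂P ≤ δ * M ^ 2 := mul_le_mul_of_nonneg_left ba2 hδ0
      nlinarith [hS2, hδa]
    · -- fourth moment
      have hexp : (fun ω ↦ (S ω + a ω * D ω) ^ 4) =
          fun ω ↦ S ω ^ 4 + 4 * (S ω ^ 3 * a ω * D ω) + 6 * (S ω ^ 2 * a ω ^ 2 * D ω ^ 2) +
            4 * (S ω * a ω ^ 3 * D ω ^ 3) + a ω ^ 4 * D ω ^ 4 := by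
        funext ω; ring
      have i1 : Integrable (fun ω ↦ 4 * (S ω ^ 3 * a ω * D ω)) P := i31.const_mul 4
      have i2 : Integrable (fun ω ↦ 6 * (S ω ^ 2 * a ω ^ 2 * D ω ^ 2)) P := i22.const_mul 6
      have i3 : Integrable (fun ω ↦ 4 * (S ω * a ω ^ 3 * D ω ^ 3)) P := i13.const_mul 4
      have i12 : Integrable (fun ω ↦ S ω ^ 4 + 4 * (S ω ^ 3 * a ω * D ω)) P := iS4.add i1
      have i123 : Integrable (fun ω ↦ S ω ^ 4 + 4 * (S ω ^ 3 * a ω * D ω) +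
          6 * (S ω ^ 2 * a ω ^ 2 * D ω ^ 2)) P := i12.add i2
      have i1234 : Integrable (fun ω ↦ S ω ^ 4 + 4 * (S ω ^ 3 * a ω * D ω) +
          6 * (S ω ^ 2 * a ω ^ 2 * D ω ^ 2) + 4 * (S ω * a ω ^ 3 * D ω ^ 3)) P := i123.add i3
      rw [hexp, integral_add i1234 i04, integral_add i123 i3, integral_add i12 i2, integral_add iS4 i1,
        integral_const_mul, integral_const_mul, integral_const_mul, e31, e13, e22, e04]
      have h6 : δ * ∫ ω, S ω ^ 2 * a ω ^ 2 ∂P ≤ δ * (M ^ 2 * (M ^ 2 * ((H.time n : ℝ) - H.time p))) :=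
        mul_le_mul_of_nonneg_left (bSa2.trans (mul_le_mul_of_nonneg_left hS2 (sq_nonneg M))) hδ0
      have h3 : 3 * δ ^ 2 * ∫ ω, a ω ^ 4 ∂P ≤ 3 * δ ^ 2 * M ^ 4 :=
        mul_le_mul_of_nonneg_left ba4 (by positivity)
      have hM4 : 0 ≤ M ^ 4 * (((H.time n : ℝ) - H.time p) * δ) :=
        mul_nonneg (by positivity) (mul_nonneg hτ0 hδ0)
      have hM4' : 0 ≤ M ^ 4 * δ ^ 2 := by positivity
      nlinarith [hS4int, h6, h3, hM4, hM4']

end Vec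

end Summit.QuantumFields.YangMills.Theorems.ColdStartUniversality

end
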